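import Summits.CriticalPhenomena.CardyFormulaZ2.Theorems.CardyComplexConeParafermionToSLESixFamiliesDiamondTracePhase
import HarnessLib
import Literature.Probability.LatticeModels.MedialWindingBridge

/-!
# The chain sum of an exact pair along a run of touch sites with a constant passage phase
# (line `potential-darboux-picard-diamond`, S1″ assembly: the free-side trace is `√3 · (phase) · Σ P(u ↔ A)`)

Crux `ParafermionToSLESixFamilies` (stmt-CriticalPhenomena-11389), line `potential-darboux-picard-diamond`, stub
`stub_exactPotentialTracePh2` (S1″), clauses (DIR)/(LOW) on a FREE side. The landed pieces give, at ONE touch site `u`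
(off both arcs, target edges of `(u, j)`, `(u, j+1)` ending on the dual-wired arc `B`), the block increment
`Ψ (faceAt u (j+2)) − Ψ (faceAt u j) = classWeight · (1 + e^{-iπ/3}) · cornerObs` (`exactPair_chainIncrement`) and, for a
DETERMINISTIC turn count `T` at `(u, j)`, `cornerObs = e^{-iπT/6} · P(passage)` (`cornerObs_eq_phase_mul_real_passes`).
The winding hypothesis of the assembly arrives as a constant PHASE `ζ` of `e^{-iπ·turnCount/6}` at the passages of
`(u, j)` (only `T mod 12` matters, and the phase form is what the frame direction `u δ · τ(p, q)` is compared with).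
This file sums the blocks along a run of consecutive touch sites of one straight side:

* `classWeight_neg_cornerOff_eq_I_pow` — the class weight of the corner `(u, faceAt u j)` is `i ^ j`;
* `cornerObs_eq_const_mul_real_passes` — constant phase `ζ` at every passage ⇒ `cornerObs = ζ · P(passage)`;
* `exactPair_blockIncrement_of_phase` — the block at one touch site:
  `Ψ (faceAt u (j+2)) − Ψ (faceAt u j) = √3 · (i^j e^{-iπ/6} ζ) · P(passage of (u, faceAt u j))`;
* `faceAt_sub_units` — consecutive touch sites `u, u − u_j − u_{j+1}` share the chain cell
  `faceAt (u − u_j − u_{j+1}) j = faceAt u (j+2)`, so the blocks telescope;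
* `exactPair_chainSum_of_phase` — the telescoped sum over a run `x 0, …, x N`, `x (i+1) = x i − u_j − u_{j+1}`;
* `exactPair_chainSum_touchProb` (registered, `--supports` the crux) — under (H1) the wired arc connected through
  `Ω_δ` and (H2) the dual-wired arc lattice-connected, `P(passage) = touchProb` at every touch corner
  (`real_passesCorner_eq_touchProb`), hence
  `Ψ (faceAt (x N) (j+2)) − Ψ (faceAt (x 0) j) = √3 · (i^j e^{-iπ/6} ζ) · Σ_{i ≤ N} touchProb E (x i)`:
  the face potential runs along the chain cells of a free side in ONE direction, with increments `√3 · P(x i ↔ A)`.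

Pure lattice statements about one admissible datum; nothing is cited.
-/

noncomputable section

namespace Summit.CriticalPhenomena.CardyFormulaZ2.Cruxes.ParafermionToSLESixFamilies.PotentialDarbouxPicardDiamond

open scoped BigOperators
open MeasureTheory Filter Set Complex
open Literature.Probability Literature.Probability.LatticeModels Literature.Probability.Percolation
open Literature.Probability.LatticeModels.DiscreteDobrushin
open Literature.Probability.RandomPlanarGeometry
open Summit.CriticalPhenomena.CardyFormulaZ2.Cruxes.EdgePrecompact.QkzStripBoundaryArm (cornerObs)
open Summit.CriticalPhenomena.CardyFormulaZ2.Cruxes.ParafermionToSLESixFamilies.IicTraceFluxPairing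
  (passesCornerAt_iff_cornerOrbit_eq passesCorner_iff_exists_cornerOrbit_eq measurableSet_passesCorner
    real_passesCorner_eq_touchProb touchProb)

variable {E : DiscreteDobrushin}

/-! ## The class weight of a coded corner -/

/-- The class weight of the corner `(u, faceAt u j)` is `i ^ j` (`1, i, −1, −i`). -/
theorem classWeight_neg_cornerOff_eq_I_pow (j : Fin 4) : classWeight (-cornerOff j) = I ^ (j : ℕ) := by
  fin_cases j
  · simpa using classWeight_neg_cornerOff_zero
  · simpa using classWeight_neg_cornerOff_one
  · simp only [Fin.reduceFinMk]
    rw [classWeight_neg_cornerOff_two]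
    show (-1 : ℂ) = I ^ 2
    rw [pow_two, I_mul_I]
  · simp only [Fin.reduceFinMk]
    rw [classWeight_neg_cornerOff_three]
    show -I = I ^ 3
    rw [pow_succ, pow_two, I_mul_I, neg_one_mul]

/-- The class weight at a coded corner, with the face written as `faceAt`. -/
theorem classWeight_faceAt_sub (u : Site 2) (j : Fin 4) : classWeight (faceAt u j - u) = I ^ (j : ℕ) := by
  rw [faceAt, sub_sub_cancel_left, classWeight_neg_cornerOff_eq_I_pow]

/-! ## The corner observable under a constant passage phase -/

/-- **The integrand of the corner observable under a constant passage phase** is the phase times the indicator of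
the passage event. -/
theorem cornerObs_integrand_eq_const_indicator (hE : E.IsZdAdmissible) {δ : ℝ} (hδ : δ ≠ 0) {u : Site 2}
    {j : Fin 4} {ζ : ℂ} (hζ : ∀ (ω : BondConfig (Site 2)) (t : ℕ), t < exitTime hE ω →
      cornerOrbit (E.bcBondConfig ω) (startCorner hE) t = (u, j) →
      Complex.exp (-(Real.pi / 6 * turnCount (E.bcBondConfig ω) (startCorner hE) t : ℝ) * I) = ζ)
    (ω : BondConfig (Site 2)) :
    (∑ k ∈ (Finset.range (medialExploration E ω).length).filter (fun k =>
        (medialExploration E ω)[k]? = some (cornerSource u (faceAt u j)) ∧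
          (medialExploration E ω)[k + 1]? = some (cornerTarget u (faceAt u j))),
        Complex.exp (-(Complex.I / 3) * ((Literature.Probability.LatticeModels.Polyline.winding
          (((medialExploration E ω).map (medialPoint δ)).take (k + 2)) : ℝ) : ℂ))) =
      {ω : BondConfig (Site 2) | ∃ k : ℕ, (medialExploration E ω)[k]? = some (cornerSource u (faceAt u j)) ∧
          (medialExploration E ω)[k + 1]? = some (cornerTarget u (faceAt u j))}.indicator (fun _ => ζ) ω := by
  rw [cornerObs_integrand_eq hE hδ u j ω]
  set F := (Finset.range (exitTime hE ω)).filter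
    (fun k => cornerOrbit (E.bcBondConfig ω) (startCorner hE) k = (u, j)) with hF
  have hconst : ∀ k ∈ F, Complex.exp (-(Real.pi / 6 * turnCount (E.bcBondConfig ω) (startCorner hE) k : ℝ) * I) = ζ := by
    intro k hk
    rw [hF, Finset.mem_filter, Finset.mem_range] at hk
    exact hζ ω k hk.1 hk.2
  rw [Finset.sum_congr rfl hconst, Finset.sum_const, nsmul_eq_mul]
  have hcard : F.card ≤ 1 := by
    refine Finset.card_le_one.2 fun a ha b hb => ?_
    rw [hF, Finset.mem_filter, Finset.mem_range] at ha hb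
    by_contra hne
    rcases Nat.lt_or_gt_of_ne hne with h | h
    · exact cornerOrbit_ne hE (isStartCorner_startCorner hE) h
        (fun i hi => isInnerFace_of_lt_exitTime hE ω (lt_trans hi hb.1)) (ha.2.trans hb.2.symm)
    · exact cornerOrbit_ne hE (isStartCorner_startCorner hE) h
        (fun i hi => isInnerFace_of_lt_exitTime hE ω (lt_trans hi ha.1)) (hb.2.trans ha.2.symm)
  by_cases hω : ω ∈ {ω : BondConfig (Site 2) | ∃ k : ℕ,
      (medialExploration E ω)[k]? = some (cornerSource u (faceAt u j)) ∧
        (medialExploration E ω)[k + 1]? = some (cornerTarget u (faceAt u j))}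
  · rw [Set.indicator_of_mem hω]
    obtain ⟨k, hk, hkq⟩ := (passesCorner_iff_exists_cornerOrbit_eq hE ω u j).1 hω
    have hkF : k ∈ F := by rw [hF, Finset.mem_filter, Finset.mem_range]; exact ⟨hk, hkq⟩
    have h1 : F.card = 1 := le_antisymm hcard (Finset.card_pos.2 ⟨k, hkF⟩)
    rw [h1, Nat.cast_one, one_mul]
  · rw [Set.indicator_of_notMem hω]
    have h0 : F = ∅ := by
      refine Finset.eq_empty_of_forall_notMem fun k hk => hω ?_
      rw [hF, Finset.mem_filter, Finset.mem_range] at hk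
      exact (passesCorner_iff_exists_cornerOrbit_eq hE ω u j).2 ⟨k, hk.1, hk.2⟩
    rw [h0, Finset.card_empty, Nat.cast_zero, zero_mul]

/-- **The corner observable under a constant passage phase**: if `e^{-iπ·turnCount/6} = ζ` at every passage of
`(u, j)` before the exit, then `cornerObs E δ u (faceAt u j) = ζ · P(passage)`. -/
theorem cornerObs_eq_const_mul_real_passes (hE : E.IsZdAdmissible) {δ : ℝ} (hδ : δ ≠ 0) {u : Site 2} {j : Fin 4}
    {ζ : ℂ} (hζ : ∀ (ω : BondConfig (Site 2)) (t : ℕ), t < exitTime hE ω →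
      cornerOrbit (E.bcBondConfig ω) (startCorner hE) t = (u, j) →
      Complex.exp (-(Real.pi / 6 * turnCount (E.bcBondConfig ω) (startCorner hE) t : ℝ) * I) = ζ) :
    cornerObs E δ u (faceAt u j) = ζ *
      (bondPercolation (zdGraph 2) half).real
        {ω : BondConfig (Site 2) | ∃ k : ℕ, (medialExploration E ω)[k]? = some (cornerSource u (faceAt u j)) ∧
          (medialExploration E ω)[k + 1]? = some (cornerTarget u (faceAt u j))} := by
  have hS := measurableSet_passesCorner E u (faceAt u j)
  unfold cornerObs
  -- buildfix 2026-08-20 (proof-only, regime-robust): `cornerObs` spells the fully-qualified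
  -- `Literature.Probability.LatticeModels.winding` (= `FermionicObservable`'s copy whenever that module is in
  -- the closure); realign it with the `Polyline.winding` of this file's lemmas (`MedialWindingBridge`; a
  -- syntactic identity once the Literature dedupe lands).
  rw [← Literature.Probability.LatticeModels.Polyline.winding_eq_winding']
  simp only
  rw [show (fun ω : BondConfig (Site 2) => _) = _ from funext (cornerObs_integrand_eq_const_indicator hE hδ hζ),
    integral_indicator hS, setIntegral_const, Measure.real, Complex.real_smul, mul_comm]

/-! ## The block increment at one touch site -/

/-- **The block increment of an exact pair at a touch site with a constant passage phase.** For the admissible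
datum `E` read at its own mesh, an exact pair `(Φ, Ψ)`, a site `u` off both arcs whose `(j+1)`-st and `(j+2)`-nd
neighbours lie on the dual-wired arc `B`, with the faces `j, j+1, j+2` at `u` inner, and a constant phase `ζ` of
`e^{-iπ·turnCount/6}` at the passages of `(u, j)`:
`Ψ (faceAt u (j+2)) − Ψ (faceAt u j) = √3 · (i^j · e^{-iπ/6} · ζ) · P(passage of (u, faceAt u j))`. -/
theorem exactPair_blockIncrement_of_phase (hE : E.IsZdAdmissible) {Φ Ψ : Site 2 → ℂ} (hP : IsExactPair E E.δ Φ Ψ)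
    {u : Site 2} {j : Fin 4} (huA : u ∉ E.zdArcA) (huB : u ∉ E.zdArcB) (hb₁ : u + cornerUnit (j + 1) ∈ E.zdArcB)
    (hb₂ : u + cornerUnit (j + 2) ∈ E.zdArcB) (h₀ : E.IsInnerFace (faceAt u j))
    (h₁ : E.IsInnerFace (faceAt u (j + 1))) (h₂ : E.IsInnerFace (faceAt u (j + 2))) {ζ : ℂ}
    (hζ : ∀ (ω : BondConfig (Site 2)) (t : ℕ), t < exitTime hE ω →
      cornerOrbit (E.bcBondConfig ω) (startCorner hE) t = (u, j) →
      Complex.exp (-(Real.pi / 6 * turnCount (E.bcBondConfig ω) (startCorner hE) t : ℝ) * I) = ζ) :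
    Ψ (faceAt u (j + 2)) - Ψ (faceAt u j) = (Real.sqrt 3 : ℂ) * (I ^ (j : ℕ) * Complex.exp (-(Real.pi / 6 : ℝ) * I) * ζ) *
      (bondPercolation (zdGraph 2) half).real
        {ω : BondConfig (Site 2) | ∃ k : ℕ, (medialExploration E ω)[k]? = some (cornerSource u (faceAt u j)) ∧
          (medialExploration E ω)[k + 1]? = some (cornerTarget u (faceAt u j))} := by
  have hclosed : ∀ ω : BondConfig (Site 2), cTgt (u, j) ∉ E.bcBondConfig ω := fun ω =>
    not_mem_bcBondConfig_of_mem_zdArcB hE (Sym2.mem_mk_right _ _) hb₁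
  have hclosed' : ∀ ω : BondConfig (Site 2), cTgt (u, j + 1) ∉ E.bcBondConfig ω := fun ω => by
    refine not_mem_bcBondConfig_of_mem_zdArcB hE (Sym2.mem_mk_right _ _) ?_
    rw [fin4_add_one_add_one]; exact hb₂
  rw [exactPair_chainIncrement E hE Φ Ψ hP u j huA huB hclosed hclosed' h₀ h₁ h₂, classWeight_faceAt_sub,
    one_add_exp_neg_pi_div_three, cornerObs_eq_const_mul_real_passes hE hE.delta_pos.ne' hζ]
  ring

/-! ## Consecutive touch sites share a chain cell -/

/-- Offset bookkeeping: `cornerOff (j + 2) = cornerOff j + u_j + u_{j+1}`. -/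
theorem cornerOff_add_two_eq (j : Fin 4) : cornerOff (j + 2) = cornerOff j + cornerUnit j + cornerUnit (j + 1) := by
  rw [cornerUnit_eq_off_sub, cornerUnit_eq_off_sub, fin4_add_one_add_one]; abel

/-- **Consecutive touch sites share a chain cell**: `faceAt (u − u_j − u_{j+1}) j = faceAt u (j + 2)`. -/
theorem faceAt_sub_units (u : Site 2) (j : Fin 4) :
    faceAt (u - cornerUnit j - cornerUnit (j + 1)) j = faceAt u (j + 2) := by
  rw [faceAt, faceAt, cornerOff_add_two_eq]; abel

/-! ## The chain sum -/

/-- **The chain sum with a constant passage phase.** Along a run `x 0, …, x N` of consecutive touch sites of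
orientation `j` (`x (i+1) = x i − u_j − u_{j+1}`), each satisfying the hypotheses of the block lemma with the same
phase `ζ`, the blocks telescope:
`Ψ (faceAt (x N) (j+2)) − Ψ (faceAt (x 0) j) = √3 · (i^j e^{-iπ/6} ζ) · Σ_{i ≤ N} P(passage of (x i, faceAt (x i) j))`. -/
theorem exactPair_chainSum_of_phase (hE : E.IsZdAdmissible) {Φ Ψ : Site 2 → ℂ} (hP : IsExactPair E E.δ Φ Ψ)
    (j : Fin 4) (ζ : ℂ) (x : ℕ → Site 2) (N : ℕ)
    (hx : ∀ i < N, x (i + 1) = x i - cornerUnit j - cornerUnit (j + 1))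
    (hgeo : ∀ i ≤ N, x i ∉ E.zdArcA ∧ x i ∉ E.zdArcB ∧ x i + cornerUnit (j + 1) ∈ E.zdArcB ∧
      x i + cornerUnit (j + 2) ∈ E.zdArcB ∧ E.IsInnerFace (faceAt (x i) j) ∧
      E.IsInnerFace (faceAt (x i) (j + 1)) ∧ E.IsInnerFace (faceAt (x i) (j + 2)))
    (hζ : ∀ i ≤ N, ∀ (ω : BondConfig (Site 2)) (t : ℕ), t < exitTime hE ω →
      cornerOrbit (E.bcBondConfig ω) (startCorner hE) t = (x i, j) →
      Complex.exp (-(Real.pi / 6 * turnCount (E.bcBondConfig ω) (startCorner hE) t : ℝ) * I) = ζ) :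
    Ψ (faceAt (x N) (j + 2)) - Ψ (faceAt (x 0) j) =
      (Real.sqrt 3 : ℂ) * (I ^ (j : ℕ) * Complex.exp (-(Real.pi / 6 : ℝ) * I) * ζ) *
        ∑ i ∈ Finset.range (N + 1), ((bondPercolation (zdGraph 2) half).real
          {ω : BondConfig (Site 2) | ∃ k : ℕ,
            (medialExploration E ω)[k]? = some (cornerSource (x i) (faceAt (x i) j)) ∧
            (medialExploration E ω)[k + 1]? = some (cornerTarget (x i) (faceAt (x i) j))} : ℂ) := by
  induction N with
  | zero =>
    obtain ⟨hA, hB, hb₁, hb₂, h₀, h₁, h₂⟩ := hgeo 0 le_rfl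
    rw [Finset.sum_range_one, exactPair_blockIncrement_of_phase hE hP hA hB hb₁ hb₂ h₀ h₁ h₂ (hζ 0 le_rfl)]
  | succ N ih =>
    have ih' := ih (fun i hi => hx i (Nat.lt_succ_of_lt hi)) (fun i hi => hgeo i (Nat.le_succ_of_le hi))
      (fun i hi => hζ i (Nat.le_succ_of_le hi))
    obtain ⟨hA, hB, hb₁, hb₂, h₀, h₁, h₂⟩ := hgeo (N + 1) le_rfl
    have hblock := exactPair_blockIncrement_of_phase hE hP hA hB hb₁ hb₂ h₀ h₁ h₂ (hζ (N + 1) le_rfl)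
    have hshare : faceAt (x (N + 1)) j = faceAt (x N) (j + 2) := by
      rw [hx N (Nat.lt_succ_self N), faceAt_sub_units]
    rw [Finset.sum_range_succ, mul_add, ← ih', ← hblock, hshare]
    ring

/-- **The chain sum of an exact pair along a run of touch sites, in terms of touch probabilities** (registered
helper of `stub_exactPotentialTracePh2`). For an admissible datum `E` with (H1) the wired arc connected through `Ω_δ`
and (H2) the dual-wired arc lattice-connected, an exact pair `(Φ, Ψ)` at mesh `E.δ`, an orientation `j`, a phase `ζ`,
and a run `x 0, …, x N` of consecutive touch sites (`x (i+1) = x i − u_j − u_{j+1}`; each `x i` off both arcs with its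
`(j+1)`-st and `(j+2)`-nd neighbours on `B` and the faces `j, j+1, j+2` inner) at whose `j`-darts the exploration has
the constant passage phase `e^{-iπ·turnCount/6} = ζ`:
`Ψ (faceAt (x N) (j+2)) − Ψ (faceAt (x 0) j) = √3 · (i^j · e^{-iπ/6} · ζ) · Σ_{i ≤ N} touchProb E (x i)`. -/
theorem exactPair_chainSum_touchProb : ∀ (E : DiscreteDobrushin) (hE : E.IsZdAdmissible), ((discreteDomainGraph E.Ω E.δ).induce E.zdArcA).Preconnected → ((zdGraph 2).induce E.zdArcB).Preconnected → ∀ (Φ Ψ : Site 2 → ℂ), IsExactPair E E.δ Φ Ψ → ∀ (j : Fin 4) (ζ : ℂ) (x : ℕ → Site 2) (N : ℕ), (∀ i < N, x (i + 1) = x i - cornerUnit j - cornerUnit (j + 1)) → (∀ i ≤ N, x i ∉ E.zdArcA ∧ x i ∉ E.zdArcB ∧ x i + cornerUnit (j + 1) ∈ E.zdArcB ∧ x i + cornerUnit (j + 2) ∈ E.zdArcB ∧ E.IsInnerFace (faceAt (x i) j) ∧ E.IsInnerFace (faceAt (x i) (j + 1)) ∧ E.IsInnerFace (faceAt (x i)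 (j + 2))) → (∀ i ≤ N, ∀ (ω : BondConfig (Site 2)) (t : ℕ), t < exitTime hE ω → cornerOrbit (E.bcBondConfig ω) (startCorner hE) t = (x i, j) → Complex.exp (-(Real.pi / 6 * turnCount (E.bcBondConfig ω) (startCorner hE) t : ℝ) * I) = ζ) → Ψ (faceAt (x N) (j + 2)) - Ψ (faceAt (x 0) j) = (Real.sqrt 3 : ℂ) * (I ^ (j : ℕ) * Complex.exp (-(Real.pi / 6 : ℝ) * I) * ζ) * ∑ i ∈ Finset.range (N + 1), (touchProb E (x i) : ℂ) := by
  intro E hE hA1 hB1 Φ Ψ hP j ζ x N hx hgeo hζ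
  rw [exactPair_chainSum_of_phase hE hP j ζ x N hx hgeo hζ]
  congr 1
  refine Finset.sum_congr rfl fun i hi => ?_
  rw [Finset.mem_range] at hi
  obtain ⟨-, -, hb₁, -, h₀, -, -⟩ := hgeo i (Nat.lt_succ_iff.1 hi)
  have hb : ∃ b : Site 2, IsCorner b (faceAt (x i) j) ∧ b ∈ E.zdArcB :=
    ⟨x i + cornerUnit (j + 1), (isCorner_add_faceAt_iff _ _ _).2 (Or.inr (fin4_add_one_add_three j).symm), hb₁⟩
  rw [real_passesCorner_eq_touchProb hE hA1 hB1 (isCorner_faceAt (x i) j) h₀ hb]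
  rfl

end Summit.CriticalPhenomena.CardyFormulaZ2.Cruxes.ParafermionToSLESixFamilies.PotentialDarbouxPicardDiamond

end
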